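import Summits.QuantumAdvantage.AdviceFreeQNC0.M19Linearisation
import HarnessLib

/-!
# M19 part 2: THEOREM B3 `segCounterLoss` (segment counters) and R19 `walkHardFSegCounterG`

PROVENANCE / PORT (ask P2-19a): authored by the planner seat qa-qnc0-p2 g19 (`HOME/qa-qnc0-p2/line19/M19Proofs.lean`, 1542 lines,
farm rc 0 / 0 sorry / 0 warnings), ported by qn-prover-3 g12 as six files `M19Linearisation` → `M19SegmentCounter` →
`M19FormExpansion` → `M19IntervalLoss` → `M19AffineTests` → `M19StepForms`; everything is placed in the namespace
`Summit.QuantumAdvantage.AdviceFreeQNC0.M19` (so `M19.winCount` / `M19.lossCount` do not shadow the cell's `AffBells22.winCount`),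
28 one-line docstrings were added, nothing else changed.  Separation NOT moved.
-/

/-! ## Theorem B3 — Stage 3–5: the segment-counter expansion, the `3p`-post design, assembly -/

namespace Summit.QuantumAdvantage.AdviceFreeQNC0.M19

open Finset

section SegB3
variable {F : Type} [Field F]

/-- rearrangement: a triple sum of a product of three one-variable factors. -/
theorem sum3_factor {α β γ : Type} [Fintype α] [Fintype β] [Fintype γ]
    (K : F) (a : α → F) (b : β → F) (c : γ → F) :
    ∑ x : (α × β) × γ, K * (a x.1.1 * b x.1.2 * c x.2) = K * ((∑ i, a i) * (∑ j, b j) * (∑ k, c k)) := by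
  rw [Fintype.sum_prod_type, Fintype.sum_prod_type]
  rw [Finset.sum_mul_sum, Finset.sum_mul, Finset.mul_sum]
  refine Finset.sum_congr rfl (fun i _ => ?_)
  rw [Finset.sum_mul, Finset.mul_sum]
  refine Finset.sum_congr rfl (fun j _ => ?_)
  rw [Finset.mul_sum, Finset.mul_sum]

variable {p : ℕ} [NeZero p] (ψ : AddChar (ZMod p) F) (η : F)

/-- coefficient of the term `(g, (r₁,r₂), (j₁,j₂), b)` of the expansion of a segment-counter strategy. -/
def segC {n : ℕ} (c : ℕ) (f : Fin (n + 1) → Fin p → Fin p → Bool)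
    (g : Fin (n + 1)) (r : Fin p × Fin p) (j : ZMod p × ZMod p) (b : Fin 2) : F :=
  (if f g r.1 r.2 = true then 1 else 0) * ψ (-(j.1 * (r.1.val : ZMod p))) * ψ (-(j.2 * (r.2.val : ZMod p)))
    * η ^ ((b.val + 1) * (c + g.val))

/-- ratio ("letter") of that term at coordinate `i`: `ξ^{j₁+j₂} η^{2b}` left of the cut, `ξ^{j₂} η^{b}` right of it. -/
def segρ {n : ℕ} (g : Fin (n + 1)) (j : ZMod p × ZMod p) (b : Fin 2) (i : Fin n) : F :=
  (if i.val < g.val then ψ j.1 * η ^ (b.val + 1) else 1) * (ψ j.2 * η ^ (b.val + 1))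

/-- the `3p` posts: blocks `μ_p·η²`, `μ_p·η`, `μ_p·η²` on coordinates `[0,p)`, `[p,2p)`, `[2p,3p)`. -/
def segα (p : ℕ) [NeZero p] (ψ : AddChar (ZMod p) F) (η : F) {n : ℕ} (i : Fin n) : F :=
  if i.val < p then ψ (i.val : ZMod p) * η ^ 2
  else if i.val < 2 * p then ψ ((i.val - p : ℕ) : ZMod p) * η ^ 1
  else ψ ((i.val - 2 * p : ℕ) : ZMod p) * η ^ 2

/-- Stage 3: the product-character expansion of the win indicator of a segment-counter strategy. -/
theorem seg_expansion [CharP F 2] (hη3 : η ^ 3 = 1) (hη1 : η ≠ 1) (hp : Odd p) {ξ : F} (hξ : IsPrimitiveRoot ξ p)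
    (hψ : ∀ z : ZMod p, ψ z = ξ ^ z.val)
    {n : ℕ} (c : ℕ) (y : Fin (n + 1) → (Fin n → Bool) → Bool) (f : Fin (n + 1) → Fin p → Fin p → Bool)
    (hf : ∀ g u, y g u = f g ⟨wtPrefix u g.val % p, Nat.mod_lt _ (NeZero.pos p)⟩ ⟨wt u % p, Nat.mod_lt _ (NeZero.pos p)⟩)
    (u : Fin n → Bool) :
    (if ringWinU c y u = true then (1 : F) else 0)
      = ∑ t : Fin (n + 1) × (Fin p × Fin p) × (ZMod p × ZMod p) × Fin 2,
          segC ψ η c f t.1 t.2.1 t.2.2.1 t.2.2.2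
            * ∏ i : Fin n, (if u i = true then segρ ψ η t.1 t.2.2.1 t.2.2.2 i else 1) := by
  classical
  rw [linearisationIdentity F η hη3 hη1 n c y u, Fintype.sum_prod_type]
  refine Finset.sum_congr rfl (fun g _ => ?_)
  have hp0 : 0 < p := NeZero.pos p
  -- (c) residue indicators as character sums
  have hres : ∀ (w : ℕ) (r : Fin p), (if w % p = r.val then (1 : F) else 0)
      = ∑ j : ZMod p, ψ (-(j * (r.val : ZMod p))) * (ψ j) ^ w := by
    intro w r
    have hce := counterExpansion F p hp ξ hξ ((w : ZMod p) - (r.val : ZMod p))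
    have hiff : ((w : ZMod p) - (r.val : ZMod p) = 0) ↔ (w % p = r.val) := by
      rw [sub_eq_zero, ZMod.natCast_eq_natCast_iff', Nat.mod_eq_of_lt r.isLt]
    rw [← if_congr hiff rfl rfl, hce]
    refine Finset.sum_congr rfl (fun j _ => ?_)
    rw [← hψ, show j * ((w : ZMod p) - (r.val : ZMod p)) = -(j * (r.val : ZMod p)) + j * (w : ZMod p) by ring,
      AddChar.map_add_eq_mul, addChar_mul_natCast]
  -- (e) the label part
  have hℓ : c + g.val + walkExp u g.val = c + g.val + wt u + wtPrefix u g.val := by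
    unfold walkExp; ring
  have hX : η ^ (c + g.val + walkExp u g.val) + η ^ (2 * (c + g.val + walkExp u g.val))
      = ∑ b : Fin 2, η ^ ((b.val + 1) * (c + g.val)) * (η ^ (b.val + 1)) ^ wt u * (η ^ (b.val + 1)) ^ wtPrefix u g.val := by
    rw [Fin.sum_univ_two, hℓ]
    simp only [Fin.val_zero, Fin.val_one, zero_add]
    rw [← pow_mul, ← pow_mul, ← pow_add, ← pow_add, ← pow_mul, ← pow_mul, ← pow_add, ← pow_add]
    congr 1 <;> ring_nf
  -- per-coordinate letters multiply up to the four power factors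
  have key : ∀ (j : ZMod p × ZMod p) (b : Fin 2),
      ∏ i : Fin n, (if u i = true then segρ ψ η g j b i else 1)
        = (ψ j.1) ^ wtPrefix u g.val * (ψ j.2) ^ wt u * ((η ^ (b.val + 1)) ^ wt u * (η ^ (b.val + 1)) ^ wtPrefix u g.val) := by
    intro j b
    rw [pow_wtPrefix_eq_prod, pow_wt_eq_prod, pow_wt_eq_prod, pow_wtPrefix_eq_prod,
      prod_boolIte_mul, prod_boolIte_mul, prod_boolIte_mul]
    refine Finset.prod_congr rfl (fun i _ => ?_)
    by_cases hu : u i = true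
    · simp only [hu, if_true]
      unfold segρ
      split_ifs <;> ring
    · simp [hu]
  symm
  calc ∑ s : (Fin p × Fin p) × (ZMod p × ZMod p) × Fin 2,
        segC ψ η c f g s.1 s.2.1 s.2.2 * ∏ i : Fin n, (if u i = true then segρ ψ η g s.2.1 s.2.2 i else 1)
      = ∑ r : Fin p × Fin p, (if f g r.1 r.2 = true then (1 : F) else 0) *
          ((∑ j₁ : ZMod p, ψ (-(j₁ * (r.1.val : ZMod p))) * (ψ j₁) ^ wtPrefix u g.val) *
           (∑ j₂ : ZMod p, ψ (-(j₂ * (r.2.val : ZMod p))) * (ψ j₂) ^ wt u) *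
           (∑ b : Fin 2, η ^ ((b.val + 1) * (c + g.val)) * (η ^ (b.val + 1)) ^ wt u * (η ^ (b.val + 1)) ^ wtPrefix u g.val)) := by
        rw [Fintype.sum_prod_type]
        refine Finset.sum_congr rfl (fun r _ => ?_)
        rw [← sum3_factor]
        refine Finset.sum_congr rfl (fun x _ => ?_)
        rw [key]
        unfold segC
        ring
    _ = ∑ r : Fin p × Fin p, (if f g r.1 r.2 = true then (1 : F) else 0) *
          ((if wtPrefix u g.val % p = r.1.val then (1 : F) else 0) * (if wt u % p = r.2.val then (1 : F) else 0) *
           (η ^ (c + g.val + walkExp u g.val) + η ^ (2 * (c + g.val + walkExp u g.val)))) := by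
        refine Finset.sum_congr rfl (fun r _ => ?_)
        rw [hres (wtPrefix u g.val) r.1, hres (wt u) r.2, hX]
    _ = (if f g ⟨wtPrefix u g.val % p, Nat.mod_lt _ hp0⟩ ⟨wt u % p, Nat.mod_lt _ hp0⟩ = true then (1 : F) else 0) *
          (η ^ (c + g.val + walkExp u g.val) + η ^ (2 * (c + g.val + walkExp u g.val))) := by
        rw [Finset.sum_eq_single (⟨wtPrefix u g.val % p, Nat.mod_lt _ hp0⟩, ⟨wt u % p, Nat.mod_lt _ hp0⟩)]
        · simp
        · intro r _ hr
          have hne : ¬ (wtPrefix u g.val % p = r.1.val ∧ wt u % p = r.2.val) := by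
            rintro ⟨h1, h2⟩
            apply hr
            ext
            · exact h1.symm
            · exact h2.symm
          by_cases h1 : wtPrefix u g.val % p = r.1.val
          · have h2 : ¬ wt u % p = r.2.val := fun h2 => hne ⟨h1, h2⟩
            simp [h2]
          · simp [h1]
        · intro h; exact absurd (Finset.mem_univ _) h
    _ = (if y g u = true then
          η ^ (c + g.val + walkExp u g.val) + η ^ (2 * (c + g.val + walkExp u g.val)) else 0) := by
        rw [hf g u]
        split_ifs <;> simp

omit [NeZero p] in
/-- no post is the trivial letter: `ψ(z)·η^e ≠ 1` for `e ∈ {1,2}` because `μ₃ ∩ μ_p = 1` (`3 ∤ p`). -/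
theorem psi_mul_eta_pow_ne_one (hη : IsPrimitiveRoot η 3) (h3 : ¬ 3 ∣ p) (hψp : ∀ z : ZMod p, (ψ z) ^ p = 1)
    (z : ZMod p) (e : ℕ) (he : e = 1 ∨ e = 2) : ψ z * η ^ e ≠ 1 := by
  intro h
  have h1 : (ψ z * η ^ e) ^ p = 1 := by rw [h, one_pow]
  rw [mul_pow, hψp, one_mul, ← pow_mul] at h1
  have hd : 3 ∣ e * p := (hη.pow_eq_one_iff_dvd _).mp h1
  rcases (Nat.Prime.dvd_mul Nat.prime_three).mp hd with h | h
  · omega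
  · exact h3 h

/-- The forbidden letters `segα` are `≠ 1`. -/
theorem segα_ne_one (hη : IsPrimitiveRoot η 3) (h3 : ¬ 3 ∣ p) (hψp : ∀ z : ZMod p, (ψ z) ^ p = 1)
    {n : ℕ} (i : Fin n) : segα p ψ η i ≠ 1 := by
  unfold segα
  split_ifs
  · exact psi_mul_eta_pow_ne_one ψ η hη h3 hψp _ 2 (Or.inr rfl)
  · exact psi_mul_eta_pow_ne_one ψ η hη h3 hψp _ 1 (Or.inl rfl)
  · exact psi_mul_eta_pow_ne_one ψ η hη h3 hψp _ 2 (Or.inr rfl)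

/-- Stage 4: the `3p`-post design hits every term. -/
theorem seg_hit (hη3 : η ^ 3 = 1) {n : ℕ} (hn : 3 * p ≤ n)
    (g : Fin (n + 1)) (j : ZMod p × ZMod p) (b : Fin 2) :
    ∃ i ∈ (Finset.univ : Finset (Fin (3 * p))).map (Fin.castLEEmb hn), segρ ψ η g j b i = segα p ψ η i := by
  have hp0 : 0 < p := NeZero.pos p
  have hη4 : η ^ 4 = η := by
    rw [show (4 : ℕ) = 3 + 1 from rfl, pow_add, hη3, one_mul, pow_one]
  have hv12 : (j.1 + j.2).val < p := ZMod.val_lt _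
  have hv2 : j.2.val < p := ZMod.val_lt _
  -- a post inside `[0, 3p)` given by its coordinate
  have post : ∀ k : ℕ, ∀ hk : k < 3 * p,
      (Fin.castLE hn ⟨k, hk⟩) ∈ (Finset.univ : Finset (Fin (3 * p))).map (Fin.castLEEmb hn) := by
    intro k hk
    exact Finset.mem_map_of_mem _ (Finset.mem_univ _)
  fin_cases b
  · -- b = 0 : letters ξ^{j₁+j₂}·η² left of g, ξ^{j₂}·η right of g
    by_cases hg : p ≤ g.val
    · refine ⟨Fin.castLE hn ⟨(j.1 + j.2).val, by omega⟩, post _ _, ?_⟩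
      unfold segρ segα
      have hlt : (j.1 + j.2).val < g.val := by omega
      simp only [Fin.castLE, hlt, if_true, hv12, ZMod.natCast_zmod_val, zero_add, AddChar.map_add_eq_mul]
      ring
    · refine ⟨Fin.castLE hn ⟨p + j.2.val, by omega⟩, post _ _, ?_⟩
      unfold segρ segα
      have h1 : ¬ (p + j.2.val < g.val) := by omega
      have h2 : ¬ (p + j.2.val < p) := by omega
      have h3' : p + j.2.val < 2 * p := by omega
      simp only [Fin.castLE, h1, if_false, h2, h3', if_true, Nat.add_sub_cancel_left, ZMod.natCast_zmod_val,
        zero_add, one_mul]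
  · -- b = 1 : letters ξ^{j₁+j₂}·η left of g, ξ^{j₂}·η² right of g
    by_cases hg : 2 * p ≤ g.val
    · refine ⟨Fin.castLE hn ⟨p + (j.1 + j.2).val, by omega⟩, post _ _, ?_⟩
      unfold segρ segα
      have hlt : p + (j.1 + j.2).val < g.val := by omega
      have h2 : ¬ (p + (j.1 + j.2).val < p) := by omega
      have h3' : p + (j.1 + j.2).val < 2 * p := by omega
      simp only [Fin.castLE, hlt, if_true, h2, if_false, h3', Nat.add_sub_cancel_left, ZMod.natCast_zmod_val,
        AddChar.map_add_eq_mul]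
      rw [show ψ j.1 * η ^ (1 + 1) * (ψ j.2 * η ^ (1 + 1)) = ψ j.1 * ψ j.2 * η ^ 4 by ring, hη4, pow_one]
    · refine ⟨Fin.castLE hn ⟨2 * p + j.2.val, by omega⟩, post _ _, ?_⟩
      unfold segρ segα
      have h1 : ¬ (2 * p + j.2.val < g.val) := by omega
      have h2 : ¬ (2 * p + j.2.val < p) := by omega
      have h3' : ¬ (2 * p + j.2.val < 2 * p) := by omega
      simp only [Fin.castLE, h1, if_false, h2, h3', Nat.add_sub_cancel_left, ZMod.natCast_zmod_val, one_mul]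

/-- **Theorem B3 (segment counters), kernel version**: `#LOSE ≥ 2^{n − 3p}` for `n ≥ 3p`, every charge,
every odd `p` with `3 ∤ p`. Closes R19 (`WalkHardFSegCounterG`) via `walkHardFSegCounterG_of_loss`. -/
theorem segCounterLoss (p : ℕ) : SegCounterLoss p := by
  intro hp h3 n c y hy hn
  classical
  haveI : NeZero p := ⟨by obtain ⟨k, hk⟩ := hp; omega⟩
  have hp0 : 0 < p := NeZero.pos p
  obtain ⟨F, instF, instC, η, ξ, hη, hξ⟩ := exists_charTwo_field_with_roots p hp
  have hη3 : η ^ 3 = 1 := hη.pow_eq_one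
  have hη1 : η ≠ 1 := hη.ne_one (by norm_num)
  let ψ : AddChar (ZMod p) F := AddChar.zmodChar p hξ.pow_eq_one
  have hψ : ∀ z : ZMod p, ψ z = ξ ^ z.val := fun z => AddChar.zmodChar_apply _ z
  have hψp : ∀ z : ZMod p, (ψ z) ^ p = 1 := by
    intro z
    rw [hψ, ← pow_mul, mul_comm, pow_mul, hξ.pow_eq_one, one_pow]
  -- the table of the strategy
  let f : Fin (n + 1) → Fin p → Fin p → Bool := fun g r₁ r₂ =>
    decide (∃ v : Fin n → Bool, wtPrefix v g.val % p = r₁.val ∧ wt v % p = r₂.val ∧ y g v = true)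
  have hf : ∀ g u, y g u = f g ⟨wtPrefix u g.val % p, Nat.mod_lt _ hp0⟩ ⟨wt u % p, Nat.mod_lt _ hp0⟩ := by
    intro g u
    cases hyu : y g u
    · symm
      apply decide_eq_false
      rintro ⟨v, h1, h2, h3v⟩
      have hsame := hy g u v (by simpa using h1.symm) (by rw [wtPrefix_eq_wt, wtPrefix_eq_wt]; simpa using h2.symm)
      rw [hyu, h3v] at hsame
      exact Bool.false_ne_true hsame
    · symm
      apply decide_eq_true
      exact ⟨u, rfl, rfl, hyu⟩
  -- posts
  have hP : ((Finset.univ : Finset (Fin (3 * p))).map (Fin.castLEEmb hn)).card = 3 * p := by simp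
  have key := loss_ge_of_posts c y (Fin (n + 1) × (Fin p × Fin p) × (ZMod p × ZMod p) × Fin 2) Finset.univ
    (fun t => segC ψ η c f t.1 t.2.1 t.2.2.1 t.2.2.2) (fun t => segρ ψ η t.1 t.2.2.1 t.2.2.2)
    ((Finset.univ : Finset (Fin (3 * p))).map (Fin.castLEEmb hn)) (segα p ψ η)
    (fun i _ => segα_ne_one ψ η hη h3 hψp i)
    (fun t _ => seg_hit ψ η hη3 hn t.1 t.2.2.1 t.2.2.2)
    (seg_expansion ψ η hη3 hη1 hp hξ hψ c y f hf)
  rw [hP] at key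
  exact key

end SegB3

end Summit.QuantumAdvantage.AdviceFreeQNC0.M19

/-! ## R19 closed: `WalkHardFSegCounterG p` and the summit-range corollary -/

namespace Summit.QuantumAdvantage.AdviceFreeQNC0.M19

open Finset

/-- number of winning inputs. -/
def winCount {n : ℕ} (c : ℕ) (y : Fin (n + 1) → (Fin n → Bool) → Bool) : ℕ :=
  (univ.filter fun u : Fin n → Bool => ringWinU c y u = true).card

/-- `winCount + lossCount = 2^n`. -/
theorem winCount_add_lossCount {n : ℕ} (c : ℕ) (y : Fin (n + 1) → (Fin n → Bool) → Bool) :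
    winCount c y + lossCount c y = 2 ^ n := by
  unfold winCount lossCount
  have h := Finset.card_filter_add_card_filter_not
    (s := (univ : Finset (Fin n → Bool))) (p := fun u : Fin n → Bool => ringWinU c y u = true)
  have h2 : (univ.filter fun u : Fin n → Bool => ¬ ringWinU c y u = true)
      = (univ.filter fun u : Fin n → Bool => ringWinU c y u = false) :=
    Finset.filter_congr (fun u _ => by simp)
  rw [h2] at h
  rw [h, Finset.card_univ, Fintype.card_fun, Fintype.card_bool, Fintype.card_fin]

/-- `#LOSE ≥ 2^{n−k}` gives `#WIN ≤ (1 − 2^{−k})·2ⁿ`. -/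
theorem win_le_of_loss_ge {n k W L : ℕ} (hWL : W + L = 2 ^ n) (hk : k ≤ n) (hL : 2 ^ (n - k) ≤ L) :
    (W : ℝ) ≤ (1 - 1 / 2 ^ k) * (2 : ℝ) ^ n := by
  have h2 : (2 : ℝ) ^ n = 2 ^ (n - k) * 2 ^ k := by rw [← pow_add, Nat.sub_add_cancel hk]
  have hW : (W : ℝ) = 2 ^ n - L := by
    have := congrArg (Nat.cast (R := ℝ)) hWL
    push_cast at this
    linarith
  have hL' : (2 : ℝ) ^ (n - k) ≤ L := by exact_mod_cast hL
  have hk' : (0 : ℝ) < 2 ^ k := by positivity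
  rw [hW]
  calc (2 : ℝ) ^ n - L ≤ 2 ^ n - 2 ^ (n - k) := by linarith
    _ = (1 - 1 / 2 ^ k) * (2 : ℝ) ^ n := by rw [h2]; field_simp

/-- **R19** (Sketch18 §6 `WalkHardFSegCounter` with the referee's guard F-R60-1): segment-counter strategies
(`y_g = F_g(W_{<g} mod p, W mod p)`, any combiners, any density) win at most `θ·2ⁿ`, `θ = 1 − 2^{−3p} < 1`, from `n = 3p` on. -/
def WalkHardFSegCounterG (p : ℕ) : Prop :=
  Odd p → ¬ 3 ∣ p → ∃ θ : ℝ, θ < 1 ∧ ∃ n₀ : ℕ, ∀ n ≥ n₀, ∀ c : ℕ,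
    ∀ y : Fin (n + 1) → (Fin n → Bool) → Bool, IsSegCounterStrategy p n y →
      ((Finset.univ.filter fun u : Fin n → Bool => ringWinU c y u = true).card : ℝ) ≤ θ * (2 : ℝ) ^ n

/-- **R19 PROVED** (`θ = 1 − 2^{−3p}`, `n₀ = 3p`). -/
theorem walkHardFSegCounterG (p : ℕ) : WalkHardFSegCounterG p := by
  intro hp h3
  refine ⟨1 - 1 / 2 ^ (3 * p), by
    have : (0 : ℝ) < 1 / 2 ^ (3 * p) := by positivity
    linarith, 3 * p, ?_⟩
  intro n hn c y hy
  exact win_le_of_loss_ge (winCount_add_lossCount c y) hn (segCounterLoss p hp h3 n c y hy hn)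

/-- the summit range: every prime `p ≥ 5` (Sketch18's unguarded `WalkHardFSegCounter p` there). -/
theorem walkHardFSegCounter_of_prime (p : ℕ) [hpr : Fact p.Prime] (hp5 : 5 ≤ p) :
    ∃ θ : ℝ, θ < 1 ∧ ∃ n₀ : ℕ, ∀ n ≥ n₀, ∀ c : ℕ,
      ∀ y : Fin (n + 1) → (Fin n → Bool) → Bool, IsSegCounterStrategy p n y →
        ((Finset.univ.filter fun u : Fin n → Bool => ringWinU c y u = true).card : ℝ) ≤ θ * (2 : ℝ) ^ n := by
  refine walkHardFSegCounterG p (hpr.out.odd_of_ne_two (by omega)) ?_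
  intro h
  have := (Nat.prime_dvd_prime_iff_eq Nat.prime_three hpr.out).mp h
  omega

end Summit.QuantumAdvantage.AdviceFreeQNC0.M19
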